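/-
COR-CM (cell pub-hodgecm2, stage 2 of the Hodge ladder) — count-neutral own lane PERL-WEIL-LINE, sequel (seat prover-pub-hodgecm2-p2, binder
prover 2, gen 23).  Theorems only; no definition, no named fact, nothing asserted.  Composition BY NAME of this seat's H
(`CorCM/PerLHodgeFourCoreIntrinsic.lean`, p300493), b25's codimension-2 reduction and frame adapter
(`CorCM/PairFlipSexticFourCoreAnyTypes.lean`: `exists_frame_normalForm`, `…_of_hodgeClasses_two_of_pairwise_ne`), the isogeny lemmas of
`CorCM/GenericCMFieldSameFieldFamiliesHodge.lean` (gen 21) and the tree's `Milne1999.isIsogeny_biproduct_map`; nothing of theirs is restated.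
NOT an E term, NOT a display of record, no BINDER-OWNERS row; `Interfaces.lean` (C1), `Assembly/ModelChain*.lean` and the `PerL`
interface untouched — `Universe.PerL` is consumed BY NAME only.

HONEST FRAMING (COORDINATOR RULING — HODGE FRAMING CORRECTION, 2026-08-21T11:55:35Z): `HC_CM` is NOT proved, here or anywhere in the
tree; `PerL(U_rec)` is proved by no tree term.  This file removes the last bookkeeping restriction («products of POWERS of the four chosen
threefolds», slot maps `κ : Fin N → Fin 4`) from the named class that `PerL` certifies: ANY finite family of CM abelian varieties with
complex multiplication by the stage-1 sextic field `K` (any CM types, any multiplicities, any realisations), and everything such a product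
dominates.
-/
import Summits.HodgeConjecture.CorCM.PerLHodgeFourCoreIntrinsic
import Summits.HodgeConjecture.CorCM.GenericCMFieldSameFieldFamiliesHodge
import Literature.AlgebraicGeometry.Milne1999.LefschetzCentraliserBiproducts
import HarnessLib

/-!
# `PerL` certifies the Hodge conjecture for EVERY product of CM abelian varieties with CM by the sextic field — any types

`K` a sextic CM field whose normal closure `L` has degree `24` or `48` (stage 1's field class; no imaginary quadratic subfield, so all
eight CM types of `K` are primitive and its CM abelian varieties are simple threefolds, four isogeny classes).  H
(`PerLFourCore.hodgeConjectureFor_of_avDominatedBy_of_perL_rec_of_pairwise_ne`) gave: `PerL(U_rec)` ⟹ the Hodge conjecture for every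
abelian variety dominated by `⨁_j A₄ (κ j)`, a product of POWERS of four chosen realisations `A₄ b ⊨ (K; Φ₄ b)` of pairwise inequivalent
types.  Here the slot map disappears:

* §1 `exists_eq_or_eq_compl_of_normalForm` — in b25's normal-form frame `e : Hom(K,ℂ) ≃ ℤ/3 × Bool` (`exists_frame_normalForm`), EVERY CM
  type `τ` of `K` equals one of the four normal-form types `Φ' b` or its conjugate (the sign vector of `τ` read in the frame is one of the
  eight rows `±phi_b`; `decide`);
* §2 **`exists_isIsogenous_biproduct_comp`** — hence every finite family `X_j ⊨ (K; τ_j)` (ANY types `τ_j`, repetitions allowed, any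
  realisations) has `⨁_j X_j` ISOGENOUS to `⨁_j A₄ (κ j)` for some slot map `κ` (realisations of equal / conjugate types are isogenous,
  `GenericCMField.isIsogenous_of_eq` / `…_of_eq_compl`, Shimura §6.1 Cor.; `Milne1999.isIsogeny_biproduct_map`);
* §3 the consequences, all with hypotheses `(hX : ∀ j, IsCMTypeRealisation (τ j) (X j) (act j) (θ j))` and `AVDominatedBy B (⨁ X)` only:
  **`hodgeConjectureFor_of_avDominatedBy_anyFamily_of_perL_rec`** — `PerL(U_rec)` ⟹ `HodgeConjectureFor B.dim B.X`;
  `…_of_perLAt_rec` — the same from `PerL`'s conclusion at the ONE field `K`;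
  **`hodgeConjectureFor_of_avDominatedBy_anyFamily_of_hodgeClasses_two`** — UNCONDITIONAL REDUCTION: if every rational `(2,2)`-class of
  the ONE twelvefold `X₀ × X₁ × X₂ × X₃ = ⨁ A₄` is algebraic, then every product of CM abelian varieties with CM by `K` and everything it
  dominates satisfies the Hodge conjecture (b25's `…_of_hodgeClasses_two_of_pairwise_ne` + §2).

One sentence (writers decide): «In the kernel, PerL(U_rec) — indeed already PerL's conclusion at one sextic CM field K of the stage-1 class —
implies the Hodge conjecture for every complex abelian variety dominated by a product of abelian varieties with complex multiplication by K
(any CM types); unconditionally, the Hodge conjecture for all of these is equivalent to its codimension-2 case on one twelvefold.»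
A NAMED CLASS conditional on stage 1's statement; NOT `HC_CM`, not `PerLFace`.

## References
* [Shimura1998] G. Shimura, *Abelian Varieties with Complex Multiplication and Modular Functions* (1998), §6.1 Corollary, §8.4.
* [Dodson1984] B. Dodson, Trans. AMS 283 (1984), §5.1 (sextic structures of order 24/48).  [MumfordAV1970] D. Mumford, §19.
* [Pohlmann1968] H. Pohlmann, Ann. of Math. 88 (1968), Thm 1.  [Milne2020HodgeClassesAV] J. S. Milne (2020), Theorem 1.
* rfwf v3 / PerL v5 (2001 programme) — the stage-1 statement `Universe.PerL` (`CorCM/Geometry/Statements.lean` :60), consumed by name.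
-/

noncomputable section

open CategoryTheory CategoryTheory.Limits NumberField
open Literature.AlgebraicGeometry Literature.AlgebraicGeometry.Motives Literature.AlgebraicGeometry.HodgeTheory
open Literature.AlgebraicGeometry.ComplexMultiplication (IsCMTypeRealisation)
open Literature.NumberTheory.Automorphic
open Summit.HodgeConjecture.CorCM.PairFlipSexticFourCore (exists_frame_normalForm)
open Summit.HodgeConjecture.CorCM.Census.PairFlipSexticFourCore (Pt phi)
open Summit.HodgeConjecture.CorCM.Domination

namespace Summit.HodgeConjecture.CorCM.PerLFourCore

/-! ## §1 Every CM type of `K` is a normal-form type or its conjugate -/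

/-- The eight sign vectors `σ : ℤ/3 → Bool` are exactly the rows `± phi_b`, `b < 4`, of b25's model type (`decide`). [folklore] -/
theorem exists_row_eq_or_eq_not : ∀ σ : ZMod 3 → Bool, ∃ b : Fin 4,
    (∀ (q : ZMod 3) (c : Bool), ((b, q, c) : Pt) ∈ phi ↔ c = σ q) ∨
      (∀ (q : ZMod 3) (c : Bool), ((b, q, c) : Pt) ∈ phi ↔ c = !σ q) := by
  decide

/-- **Every CM type of `K` is one of the four normal-form types or its conjugate.**  In a frame `e : Hom(K, ℂ) ≃ ℤ/3 × Bool` in which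
complex conjugation flips the sign (`he_conj`) and the four types `Φ' b` are read by b25's model table `phi` (`hΦ'`, the normal form of
`exists_frame_normalForm`), the embedding set of any CM type `τ` is `(Φ' b).1` or its complement for some `b < 4` (a CM type picks one
embedding at each of the three places: a sign vector, one of eight). [cite: Shimura1998, §8.4 (CM types of a sextic field)] -/
theorem exists_eq_or_eq_compl_of_normalForm {K : Type} [Field K] {e : (K →+* ℂ) ≃ ZMod 3 × Bool}
    (he_conj : ∀ s : K →+* ℂ, e (ComplexEmbedding.conjugate s) = ((e s).1, !(e s).2)) {Φ' : Fin 4 → CMType K}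
    (hΦ' : ∀ (b : Fin 4) (s : K →+* ℂ), s ∈ (Φ' b).1 ↔ ((b, (e s).1, (e s).2) : Pt) ∈ phi) (τ : CMType K) :
    ∃ b : Fin 4, τ.1 = (Φ' b).1 ∨ τ.1 = (Φ' b).1ᶜ := by
  classical
  -- the two lifts of a place are complex conjugate
  have hsymm : ∀ q : ZMod 3, e.symm (q, false) = ComplexEmbedding.conjugate (e.symm (q, true)) := fun q =>
    e.injective (by rw [Equiv.apply_symm_apply, he_conj, Equiv.apply_symm_apply]; rfl)
  -- the sign vector of `τ` in the frame, and `τ` read through it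
  let σ : ZMod 3 → Bool := fun q => decide (e.symm (q, true) ∈ τ.1)
  have hσ : ∀ s : K →+* ℂ, s ∈ τ.1 ↔ (e s).2 = σ (e s).1 := by
    intro s
    obtain ⟨⟨q, c⟩, rfl⟩ := e.symm.surjective s
    rw [Equiv.apply_symm_apply]
    cases c
    · -- `e⁻¹ (q, −) = (e⁻¹ (q, +))‾ ∈ τ ↔ e⁻¹ (q, +) ∉ τ`
      rw [hsymm, τ.2 (ComplexEmbedding.conjugate (e.symm (q, true))), ComplexEmbedding.involutive_conjugate K]
      exact ⟨fun h => (decide_eq_false h).symm, fun h => of_decide_eq_false h.symm⟩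
    · exact ⟨fun h => (decide_eq_true h).symm, fun h => of_decide_eq_true h.symm⟩
  obtain ⟨b, hb | hb⟩ := exists_row_eq_or_eq_not σ
  · refine ⟨b, Or.inl (Set.ext fun s => ?_)⟩
    rw [hσ s, hΦ' b s, hb]
  · refine ⟨b, Or.inr (Set.ext fun s => ?_)⟩
    rw [Set.mem_compl_iff, hσ s, hΦ' b s, hb]
    generalize (e s).2 = c
    generalize σ (e s).1 = d
    cases c <;> cases d <;> decide

/-! ## §2 Any finite family of CM abelian varieties with CM by `K` is isogenous to a product of powers of the four cores -/

section AnyFamily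

variable {K : Type} [Field K] [NumberField K] [IsCMField K] (h6 : Module.finrank ℚ K = 6)
  (L : Type) [Field L] [NumberField L] [IsNormalClosure ℚ K L]
  (hL : Module.finrank ℚ L = 24 ∨ Module.finrank ℚ L = 48)
  {A₄ : Fin 4 → AbelianVariety ℂ} {Φ₄ : Fin 4 → CMType K} {ι₄ : ∀ b : Fin 4, 𝓞 K →+* End (A₄ b)}
  {θ₄ : ∀ b : Fin 4, K →+* Module.End ℂ (complexBetti (A₄ b).X 1)}
  {N : ℕ} {X : Fin (N + 1) → AbelianVariety ℂ} {τ : Fin (N + 1) → CMType K} {act : ∀ j, 𝓞 K →+* End (X j)}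
  {θX : ∀ j, K →+* Module.End ℂ (complexBetti (X j).X 1)}

include h6 hL in
/-- **ANY finite family of CM abelian varieties with CM by `K` is isogenous to a product of powers of four cores.**  `K` sextic CM with
normal closure of degree `24` or `48`; `A₄ b ⊨ (K; Φ₄ b)`, `b < 4`, realisations of four pairwise different, pairwise non-conjugate CM
types; `X_j ⊨ (K; τ_j)`, `j ≤ N`, ANY realisations of ANY CM types of `K`.  Then `⨁_j X_j` is isogenous to `⨁_j A₄ (κ j)` for some slot
map `κ` (b25's normal-form frame `exists_frame_normalForm`; §1; realisations of equal or conjugate CM types are isogenous,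
`GenericCMField.isIsogenous_of_eq` / `…_of_eq_compl`; componentwise isogenies of biproducts, `Milne1999.isIsogeny_biproduct_map`).
[cite: Shimura1998, §6.1 Corollary of Theorem 2 and §8.4] [cite: MumfordAV1970, §19] -/
theorem exists_isIsogenous_biproduct_comp (hA : ∀ b, IsCMTypeRealisation (Φ₄ b) (A₄ b) (ι₄ b) (θ₄ b))
    (hne : ∀ a b : Fin 4, a ≠ b → ∃ s, ¬ (s ∈ (Φ₄ a).1 ↔ s ∈ (Φ₄ b).1))
    (hnc : ∀ a b : Fin 4, a ≠ b → ∃ s, ¬ (s ∈ (Φ₄ a).1 ↔ s ∉ (Φ₄ b).1))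
    (hX : ∀ j, IsCMTypeRealisation (τ j) (X j) (act j) (θX j)) :
    ∃ κ : Fin (N + 1) → Fin 4, AbelianVariety.IsIsogenous (⨁ X) (⨁ fun j => A₄ (κ j)) := by
  obtain ⟨e, Φ', ι', θ', hA', he_conj, -, hΦ'⟩ := exists_frame_normalForm h6 L hL hA hne hnc
  have hcl := fun j => exists_eq_or_eq_compl_of_normalForm he_conj hΦ' (τ j)
  choose κ hκ using hcl
  have hiso : ∀ j, AbelianVariety.IsIsogenous (X j) (A₄ (κ j)) := fun j => by
    rcases hκ j with h | h
    · exact GenericCMField.isIsogenous_of_eq (hX j) (hA' (κ j)) (Subtype.ext h.symm)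
    · exact GenericCMField.isIsogenous_of_eq_compl (hX j) (hA' (κ j)) (by rw [h, compl_compl])
  choose g hg using hiso
  exact ⟨κ, biproduct.map g, Milne1999.isIsogeny_biproduct_map hg⟩

include h6 hL in
/-- **… hence dominated by such a product** (`Domination.AVDominatedBy`). [cite: MumfordAV1970, §19 Thm. 1 and p. 169] -/
theorem exists_avDominatedBy_biproduct_comp (hA : ∀ b, IsCMTypeRealisation (Φ₄ b) (A₄ b) (ι₄ b) (θ₄ b))
    (hne : ∀ a b : Fin 4, a ≠ b → ∃ s, ¬ (s ∈ (Φ₄ a).1 ↔ s ∈ (Φ₄ b).1))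
    (hnc : ∀ a b : Fin 4, a ≠ b → ∃ s, ¬ (s ∈ (Φ₄ a).1 ↔ s ∉ (Φ₄ b).1))
    (hX : ∀ j, IsCMTypeRealisation (τ j) (X j) (act j) (θX j)) {B : AbelianVariety ℂ} (hB : AVDominatedBy B (⨁ X)) :
    ∃ κ : Fin (N + 1) → Fin 4, AVDominatedBy B (⨁ fun j => A₄ (κ j)) := by
  obtain ⟨κ, hiso⟩ := exists_isIsogenous_biproduct_comp h6 L hL hA hne hnc hX
  exact ⟨κ, hB.trans (AVDominatedBy.of_isIsogenous hiso (AVDominatedBy.refl _))⟩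

include h6 hL in
/-- **UNCONDITIONAL REDUCTION TO ONE TWELVEFOLD.**  `K` sextic CM with normal closure of degree `24` or `48`, `A₄ b ⊨ (K; Φ₄ b)` four
pairwise inequivalent types: if every rational `(2,2)`-class of `X₀ × X₁ × X₂ × X₃ = ⨁ A₄` is algebraic, then EVERY finite product
`⨁_j X_j` of CM abelian varieties with CM by `K` — any CM types, any multiplicities, any realisations — and every complex abelian variety
it dominates satisfy the Hodge conjecture in every codimension (b25's `…_of_hodgeClasses_two_of_pairwise_ne` + §2).  Neither side is asserted.
[cite: Pohlmann1968, Thm 1] [cite: Shimura1998, §6.1 Corollary of Theorem 2] [cite: MumfordAV1970, §19] -/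
theorem hodgeConjectureFor_of_avDominatedBy_anyFamily_of_hodgeClasses_two
    (hA : ∀ b, IsCMTypeRealisation (Φ₄ b) (A₄ b) (ι₄ b) (θ₄ b))
    (hne : ∀ a b : Fin 4, a ≠ b → ∃ s, ¬ (s ∈ (Φ₄ a).1 ↔ s ∈ (Φ₄ b).1))
    (hnc : ∀ a b : Fin 4, a ≠ b → ∃ s, ¬ (s ∈ (Φ₄ a).1 ↔ s ∉ (Φ₄ b).1))
    (h2 : ∀ c : complexBetti (⨁ A₄).X (2 * 2), IsRationalClass c →
      IsOfHodgeType (⨁ A₄).dim (⨁ A₄).X (2 * 2) 2 2 c → c ∈ algebraicClasses (⨁ A₄).X 2)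
    (hX : ∀ j, IsCMTypeRealisation (τ j) (X j) (act j) (θX j)) {B : AbelianVariety ℂ} (hB : AVDominatedBy B (⨁ X)) :
    HodgeConjectureFor B.dim B.X := by
  obtain ⟨κ, hBκ⟩ := exists_avDominatedBy_biproduct_comp h6 L hL hA hne hnc hX hB
  exact PairFlipSexticFourCore.hodgeConjectureFor_of_avDominatedBy_comp_of_hodgeClasses_two_of_pairwise_ne h6 L hL hA hne hnc
    h2 κ hBκ

include h6 hL in
/-- The product `⨁_j X_j` itself, under the same codimension-2 hypothesis. [cite: Pohlmann1968, Thm 1] [cite: MumfordAV1970, §19] -/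
theorem hodgeConjectureFor_anyFamily_of_hodgeClasses_two (hA : ∀ b, IsCMTypeRealisation (Φ₄ b) (A₄ b) (ι₄ b) (θ₄ b))
    (hne : ∀ a b : Fin 4, a ≠ b → ∃ s, ¬ (s ∈ (Φ₄ a).1 ↔ s ∈ (Φ₄ b).1))
    (hnc : ∀ a b : Fin 4, a ≠ b → ∃ s, ¬ (s ∈ (Φ₄ a).1 ↔ s ∉ (Φ₄ b).1))
    (h2 : ∀ c : complexBetti (⨁ A₄).X (2 * 2), IsRationalClass c →
      IsOfHodgeType (⨁ A₄).dim (⨁ A₄).X (2 * 2) 2 2 c → c ∈ algebraicClasses (⨁ A₄).X 2)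
    (hX : ∀ j, IsCMTypeRealisation (τ j) (X j) (act j) (θX j)) : HodgeConjectureFor (⨁ X).dim (⨁ X).X :=
  hodgeConjectureFor_of_avDominatedBy_anyFamily_of_hodgeClasses_two h6 L hL hA hne hnc h2 hX (AVDominatedBy.refl _)

end AnyFamily

/-! ## §3 `PerL` ⟹ the Hodge conjecture for every product of CM abelian varieties with CM by `K` -/

section PerL

variable {K : CMField} {A₄ : Fin 4 → AbelianVariety ℂ} {Φ₄ : Fin 4 → CMType (K : Type)}
  {ι₄ : ∀ b : Fin 4, 𝓞 (K : Type) →+* End (A₄ b)} {θ₄ : ∀ b : Fin 4, (K : Type) →+* Module.End ℂ (complexBetti (A₄ b).X 1)}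
  {N : ℕ} {X : Fin (N + 1) → AbelianVariety ℂ} {τ : Fin (N + 1) → CMType (K : Type)}
  {act : ∀ j, 𝓞 (K : Type) →+* End (X j)} {θX : ∀ j, (K : Type) →+* Module.End ℂ (complexBetti (X j).X 1)}

/-- **FIELD-LOCAL form.**  If `PerL`'s conclusion holds AT the sextic field `K` (normal closure `L` of degree `24`/`48`; for every frame,
every embedding of `L` over the base place and every PerL quadruple, ONE hermitian space with a non-zero period on the universe of record),
then every complex abelian variety dominated by a finite product `⨁_j X_j` of CM abelian varieties with CM by `K` — ANY CM types `τ_j`,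
any realisations — satisfies the Hodge conjecture in every codimension.  (H's `…_of_perLAt_rec_of_pairwise_ne` + §2; the four cores
`A₄` are auxiliary: any four pairwise inequivalent realisations.)  FRAMING: a NAMED CLASS conditional on a period statement; NOT `HC_CM`.
[cite: Pohlmann1968, Thm 1] [cite: Shimura1998, §6.1 Corollary of Theorem 2] [cite: Milne2020HodgeClassesAV, Theorem 1] -/
theorem hodgeConjectureFor_of_avDominatedBy_anyFamily_of_perLAt_rec (L : CMField)
    (j : (K : Type) →+* (L : Type)) (hN : IsNormalClosure ℚ (K : Type) (L : Type))
    (h6 : Module.finrank ℚ K = 6) (hL : Module.finrank ℚ L = 24 ∨ Module.finrank ℚ L = 48)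
    (hK : ∀ (φ : Fin 3 → ((K : Type) →+* ℂ)), IsFrame φ → ∀ (ι₁ : (L : Type) →+* ℂ), ι₁.comp j = φ 0 →
      ∀ (t : Fin 4 → CMType (K : Type)), IsPerLTypes φ t → ∃ V : HermSpace3 L ι₁,
        (Model.picardCMUniverse exists_isReal_hodgeModel_holds hodgePQ_independent_of_hodgeModel_holds
          BallQuotient.ballQuotientUniformised_holds cmAbelianVarietyRealised_holds).PeriodNV ι₁ V K t (φ 0))
    (hA : ∀ b, IsCMTypeRealisation (Φ₄ b) (A₄ b) (ι₄ b) (θ₄ b))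
    (hne : ∀ a b : Fin 4, a ≠ b → ∃ s, ¬ (s ∈ (Φ₄ a).1 ↔ s ∈ (Φ₄ b).1))
    (hnc : ∀ a b : Fin 4, a ≠ b → ∃ s, ¬ (s ∈ (Φ₄ a).1 ↔ s ∉ (Φ₄ b).1))
    (hX : ∀ j, IsCMTypeRealisation (τ j) (X j) (act j) (θX j)) {B : AbelianVariety ℂ} (hB : AVDominatedBy B (⨁ X)) :
    HodgeConjectureFor B.dim B.X := by
  haveI := hN
  obtain ⟨κ, hBκ⟩ := exists_avDominatedBy_biproduct_comp h6 (L : Type) hL hA hne hnc hX hB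
  exact hodgeConjectureFor_of_avDominatedBy_of_perLAt_rec_of_pairwise_ne L j hN h6 hL hK hA hne hnc κ hBκ

/-- **`PerL(U_rec)` ⟹ the Hodge conjecture for every complex abelian variety dominated by a finite product of CM abelian varieties with
complex multiplication by `K`** — any CM types, any multiplicities, any realisations (`K` sextic CM, normal closure of degree `24` or `48`;
the four cores `A₄` auxiliary).  `Universe.PerL` is consumed BY NAME on the universe of record.  FRAMING: a NAMED CLASS conditional on
stage 1's statement; `PerL(U_rec)` is proved by no tree term; NOT `HC_CM`, not `PerLFace`. [cite: Pohlmann1968, Thm 1]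
[cite: Shimura1998, §6.1 Corollary of Theorem 2] [cite: Milne2020HodgeClassesAV, Theorem 1] [cite: MumfordAV1970, §19] -/
theorem hodgeConjectureFor_of_avDominatedBy_anyFamily_of_perL_rec
    (hP : (Model.picardCMUniverse exists_isReal_hodgeModel_holds hodgePQ_independent_of_hodgeModel_holds
      BallQuotient.ballQuotientUniformised_holds cmAbelianVarietyRealised_holds).PerL)
    (L : CMField) (j : (K : Type) →+* (L : Type)) (hN : IsNormalClosure ℚ (K : Type) (L : Type))
    (h6 : Module.finrank ℚ K = 6) (hL : Module.finrank ℚ L = 24 ∨ Module.finrank ℚ L = 48)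
    (hA : ∀ b, IsCMTypeRealisation (Φ₄ b) (A₄ b) (ι₄ b) (θ₄ b))
    (hne : ∀ a b : Fin 4, a ≠ b → ∃ s, ¬ (s ∈ (Φ₄ a).1 ↔ s ∈ (Φ₄ b).1))
    (hnc : ∀ a b : Fin 4, a ≠ b → ∃ s, ¬ (s ∈ (Φ₄ a).1 ↔ s ∉ (Φ₄ b).1))
    (hX : ∀ j, IsCMTypeRealisation (τ j) (X j) (act j) (θX j)) {B : AbelianVariety ℂ} (hB : AVDominatedBy B (⨁ X)) :
    HodgeConjectureFor B.dim B.X :=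
  hodgeConjectureFor_of_avDominatedBy_anyFamily_of_perLAt_rec L j hN h6 hL (hP K L j hN h6 hL) hA hne hnc hX hB

/-- The product `⨁_j X_j` itself, from `PerL(U_rec)`. [cite: Pohlmann1968, Thm 1] [cite: Milne2020HodgeClassesAV, Theorem 1] -/
theorem hodgeConjectureFor_anyFamily_of_perL_rec
    (hP : (Model.picardCMUniverse exists_isReal_hodgeModel_holds hodgePQ_independent_of_hodgeModel_holds
      BallQuotient.ballQuotientUniformised_holds cmAbelianVarietyRealised_holds).PerL)
    (L : CMField) (j : (K : Type) →+* (L : Type)) (hN : IsNormalClosure ℚ (K : Type) (L : Type))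
    (h6 : Module.finrank ℚ K = 6) (hL : Module.finrank ℚ L = 24 ∨ Module.finrank ℚ L = 48)
    (hA : ∀ b, IsCMTypeRealisation (Φ₄ b) (A₄ b) (ι₄ b) (θ₄ b))
    (hne : ∀ a b : Fin 4, a ≠ b → ∃ s, ¬ (s ∈ (Φ₄ a).1 ↔ s ∈ (Φ₄ b).1))
    (hnc : ∀ a b : Fin 4, a ≠ b → ∃ s, ¬ (s ∈ (Φ₄ a).1 ↔ s ∉ (Φ₄ b).1))
    (hX : ∀ j, IsCMTypeRealisation (τ j) (X j) (act j) (θX j)) : HodgeConjectureFor (⨁ X).dim (⨁ X).X :=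
  hodgeConjectureFor_of_avDominatedBy_anyFamily_of_perL_rec hP L j hN h6 hL hA hne hnc hX (AVDominatedBy.refl _)

end PerL

end Summit.HodgeConjecture.CorCM.PerLFourCore
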